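import Literature.NumberTheory.Automorphic.UnitaryGroupPrincipalSeriesExponents
import Literature.NumberTheory.Automorphic.MatrixCoefficients
import HarnessLib

/-!
# Proper subrepresentations of the principal series `i_G(χ)` of `U(3)` over a `p`-adic field with `|χ(a)| < 1` on `A⁻` are
# square-integrable modulo the centre ([Casselman1995] Prop. 7.1.3) — ONE NAMED FACT, CM instance at a non-split place

Topic `NumberTheory/Automorphic`; namespace `Literature.NumberTheory.Automorphic.UnitaryGroup`.  ONE NAMED FACT
`def U3PrincipalSeriesSubrepSquareIntegrable (L) : Prop` (net debt +1, declared; a printed theorem used as a HYPOTHESIS); statement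
only; no `sorry`, no instance, no notation.  Registry pub/hodgecm-mathlib F0∕P3, typer seat T3a: node N5′ of the statement tree of ★ NF1
`Rogawski1990.KeysCaseTwo` (the clause «`π²(ξ)` — the proper subrepresentation of `i_G(χ_ξ)` — is square-integrable»).  Vocabulary: ★
`cmPrincipalSeries` (`Automorphic/UnitaryGroupBorelInduction`), ★ `cmTorusCharPair` (`Automorphic/UnitaryGroupPrincipalSeriesExponents`),
★ `Representation.IsSquareIntegrableModCenter` (`Automorphic/MatrixCoefficients`), ★ `unitModulusChar` (`‖·‖_E`), Mathlib `Subrepresentation`.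

Source (read at the page).  [Casselman1995] draft 1 May 1995, §7.1 p. 67 (maximal proper parabolic `P = MN`, «the split torus `A/A_Δ` is
one-dimensional», `σ` irreducible absolutely cuspidal on `M`, `I = i_P^G σ`, «the restriction of `σ` to `A` will be a scalar character»):
«**Proposition 7.1.3.** Suppose that `σ|A_Δ` is unitary and that `|σ(a)| < 1` for `a ∈ A⁻ ∖ A_∅(O)A_Δ`. Then any proper subrepresentation
`π ⊆ I` is square-integrable mod `Z_G`.  Proof. First suppose `P = P̄`. Since the quotient `I/π` must have `(I/π)_N ≠ 0` by 6.3.7 and 1.2.3,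
and there exists a non-trivial map from `π_N` to `σδ_P^{1/2}` by Frobenius reciprocity, one has `π_N = σδ_P^{1/2}` by 7.1.1(a). The
condition of 6.5.1 is thus satisfied.»  (6.5.1 ⇐ 4.4.6 = the square-integrability criterion, ★ fact `U3SquareIntegrableExponents`; §1.4 p. 13:
`A_Θ⁻ = {a ∈ A_Θ : |α(a)| ≤ 1 for all α ∈ Δ ∖ Θ}`.)

THE INSTANCE.  `G = U(Φ₃)(L⁺_v)` at a NON-SPLIT finite place `v` (`E = L_w`, `F = L⁺_v`), `P = B = TN` the upper-triangular Borel (Θ = ∅;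
maximal AND minimal; `P = P̄`), `σ = χ = (χ₁, χ₂)` a CONTINUOUS character of `T = {d(α, β, ᾱ⁻¹)}`.  The maximal split torus is
`A = {d(t, 1, t⁻¹) : t ∈ F^×}`, `α(d(t,1,t⁻¹)) = t` on the root space `E₁₂ ⊂ Lie N`, so `A⁻ ∖ A_∅(O)A_Δ = {d(t,1,t⁻¹) : |t|_F < 1}` and
`σ(d(t,1,t⁻¹)) = χ₁(t) χ₂(det) = χ₁(t)` (`det d(t,1,t⁻¹) = 1`); `|t|_F < 1 ⇔ ‖t‖_E < 1` (★ `unitModulusChar`, `‖t‖_E = |t|_F²` for `t ∈ F`).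
The centre of `U(3)` is `U(1) = E¹` (compact, anisotropic), so `A_Δ = 1` and the hypothesis «`σ|A_Δ` unitary» is VACUOUS here — recorded, not
dropped.  So the hypothesis reads: `‖χ₁(t)‖ < 1` for every `σ`-fixed unit `t` of `L_v` (`t ∈ F^×`) with `‖t‖_E < 1`; the conclusion: every
`G`-stable subspace `N ≠ i_G(χ)` (Mathlib `Subrepresentation`, as the representation ★ `Subrepresentation.toRepresentation`) is square-integrable
modulo the centre (★ `IsSquareIntegrableModCenter μZ`, for a Haar measure `μZ` on `G ⧸ Z(G)`, the binder shape of ★ NF1 `KeysCaseTwo`).  At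
`χ = χ_ξ = (η̃₁ μ ‖·‖^{1/2}, η₂)` of [Rogawski1990, §12.2 (2)]: `‖χ₁(t)‖ = ‖t‖_E^{1/2} < 1` (`|μ(t)| = 1` on `F^×` since `μ(t)² = μ(t t̄) = 1`), so the
fact yields «`π²(ξ) ⊆ i_G(χ_ξ)` is square-integrable».  `-- TODO(general form): [Casselman1995, Prop. 7.1.3] for any maximal parabolic of
any connected reductive G (both cases P = P̄ and P ≠ P̄).`  HC_CM is proved only modulo the printed citations until rung 0 closes; this fact ENTERS
that list only if a line consumes it.

## References
* [Casselman1995] W. Casselman, *Introduction to the theory of admissible representations of `p`-adic reductive groups*,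
  draft 1 May 1995, Prop. 7.1.3 p. 67 (with §1.4 p. 13, Lemma 7.1.1, Thm. 6.5.1, Thm. 4.4.6).
* [Rogawski1990] J. D. Rogawski, *Automorphic Representations of Unitary Groups in Three Variables*, Ann. of Math. Stud. 123
  (1990), §12.2 (2) pp. 173–174 («`i_G(χ)` has a unique square-integrable constituent»).
-/

noncomputable section

open MeasureTheory NumberField IsDedekindDomain
open scoped MatrixGroups NNReal

namespace Literature.NumberTheory.Automorphic

namespace UnitaryGroup

variable (L : Type) [Field L] [NumberField L] [IsCMField L]

/-- **NAMED FACT (N5′) — PROPER SUBREPRESENTATIONS OF `i_G(χ)` WITH `|χ| < 1` ON `A⁻` ARE SQUARE-INTEGRABLE** [Casselman1995 Prop. 7.1.3]: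
at every NON-SPLIT finite place `v` of `L⁺`, for all CONTINUOUS characters `χ₁` of `L_v^×` and `χ₂` of `E¹_v` such that `‖χ₁(t)‖ < 1` for every
`σ`-fixed unit `t` of `L_v` (`t ∈ L⁺_v^×`) with `‖t‖_{L_v} < 1` (★ `unitModulusChar`; print's «`|σ(a)| < 1` for `a ∈ A⁻ ∖ A_∅(O)A_Δ`»,
`a = d(t, 1, t⁻¹)`, `σ(a) = χ₁(t)`), and every Haar measure `μZ` on `G ⧸ Z(G)`, `G = U(Φ₃)(L⁺_v)` (the carrier `↥(unitaryGroupOfForm (c ⊗ 1) Φ₃)`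
of ★ `cmPrincipalSeries`, `= (cmDatum L 3 Φ₃).Local v` by ★ `cmDatum_Local_eq`, `rfl`): EVERY PROPER `G`-STABLE SUBSPACE `N ≠ i_G(χ)` of
the principal series `i_G(χ)`, `χ = (χ₁, χ₂)` (★ `cmPrincipalSeries L 3 v (cmTorusCharPair L v χ₁ χ₂)`), is square-integrable modulo the centre
(★ `Representation.IsSquareIntegrableModCenter μZ` of ★ `Subrepresentation.toRepresentation`).  Print: «Suppose that `σ|A_Δ` is unitary and
that `|σ(a)| < 1` for `a ∈ A⁻ ∖ A_∅(O)A_Δ`. Then any proper subrepresentation `π ⊆ I` is square-integrable mod `Z_G`.» (`A_Δ = 1` for `U(3)`: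
the first hypothesis is vacuous.)  Used as a HYPOTHESIS; nothing in the tree proves it.
[cite: Casselman1995, Prop. 7.1.3 p. 67; §1.4 p. 13] [cite: Rogawski1990, §12.2 (2) pp. 173–174] -/
def U3PrincipalSeriesSubrepSquareIntegrable : Prop :=
  ∀ (v : HeightOneSpectrum (𝓞 ↥(maximalRealSubfield L))),
    (∀ w : PlacesOver L v, IsCMField.complexConj L • w.1 = w.1) →
    ∀ (χ₁ : (LocalRing L v)ˣ →* ℂˣ) (χ₂ : ↥(normOneUnits (conjLocal L (IsCMField.complexConj L) v)) →* ℂˣ),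
      Continuous (fun x => ((χ₁ x : ℂˣ) : ℂ)) → Continuous (fun x => ((χ₂ x : ℂˣ) : ℂ)) →
      (∀ t : (LocalRing L v)ˣ, conjLocal L (IsCMField.complexConj L) v (t : LocalRing L v) = t →
        unitModulusChar (LocalRing L v) t < 1 → ‖((χ₁ t : ℂˣ) : ℂ)‖ < 1) →
    ∀ [MeasurableSpace
          (↥(unitaryGroupOfForm (conjLocal L (IsCMField.complexConj L) v) (cmLocalForm L 3 v)) ⧸
            Subgroup.center ↥(unitaryGroupOfForm (conjLocal L (IsCMField.complexConj L) v) (cmLocalForm L 3 v)))]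
      [BorelSpace
          (↥(unitaryGroupOfForm (conjLocal L (IsCMField.complexConj L) v) (cmLocalForm L 3 v)) ⧸
            Subgroup.center ↥(unitaryGroupOfForm (conjLocal L (IsCMField.complexConj L) v) (cmLocalForm L 3 v)))]
      (μZ : Measure
          (↥(unitaryGroupOfForm (conjLocal L (IsCMField.complexConj L) v) (cmLocalForm L 3 v)) ⧸
            Subgroup.center ↥(unitaryGroupOfForm (conjLocal L (IsCMField.complexConj L) v) (cmLocalForm L 3 v))))
      [μZ.IsHaarMeasure],
    ∀ N : Subrepresentation (cmPrincipalSeries L 3 v (cmTorusCharPair L v χ₁ χ₂)), N ≠ ⊤ →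
      N.toRepresentation.IsSquareIntegrableModCenter μZ

end UnitaryGroup

end Literature.NumberTheory.Automorphic

end
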